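import Summits.RiemannHypothesis.RiemannHypothesis.Theorems.TiltedLandingLaw421R3CreditBooks

/-! # trkD_v13q — skeleton for `TiltedLandingLaw421R` at `halfPurse`

SUPERSEDES v11q e5f3c2cea72a0413 whose RATE stub `stub_farEnergyLawCQ : FarEnergyLawCQ (4/5)` is REFUTED (NEG 10, X3 j = 35) and whose
W-type successors died as images (NEG 11 TE*, NEG 12 COMB-2, NEG 13 COMB-4 — FINAL); SUCC side unchanged (TopPinning = analytic law,
RegUmbrella11S = residual); RATE side = the target's exact books (`…R3RateBooksQ` `restRateBotQ_iff_books`) split into two CLASS laws with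
half shares (`…R3CreditBooks` LAND #1249): purse-shaped, NOT local — DESIGN NOTE 4 (`Cruxes/…/Lens2_LOCAL-OMEGA-v1.md`) records why no local
summable law is available; daylight = `restRateBotPQ_half_iff_sum`; each half attacked alone and unrefuted on every design in hand (crit-1 g8
l.9081/l.9089); registered by PRIMARY ruling 2026-08-31T13:50Z on director-rh BLOCK 155 H1″; nothing here bears on the truth of RH. -/

namespace Summit.RiemannHypothesis.RiemannHypothesis.Cruxes.TiltedLandingLaw421R.TrkDV13q

/-- stub (SUCC, v11q verbatim): top pinning. -/
theorem stub_topPinning : RhW08.Lens1Pinning.TopPinning := by sorry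

/-- stub (SUCC, v11q verbatim): the regular umbrella at cut 11. -/
theorem stub_regUmbrella11S : RhW08.Lens1Pinning.RegUmbrella11S := by sorry

/-- stub (RATE, LAW A): charged EMPTY-tent levels, net of their sinks, cost at most half the half-purse slack. -/
theorem stub_emptyNetLawHalf : RhW08.CreditBooks.EmptyNetLawHalfQ := by sorry

/-- stub (RATE, LAW B): charged CROWDED levels, net of their sinks, cost at most the tent refunds plus half the half-purse slack. -/
theorem stub_crowdedCreditLawHalf : RhW08.CreditBooks.CrowdedCreditLawHalfQ := by sorry

/-- (K) COMPOSITION (CLOSED, registry shape v4q…v12q; desk g33 l.9102): the crux decl BY NAME, obtained by applying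
`RhW08.CreditBooks.law421R_of_creditNet_half` (token 80) to the four declared stubs; the curried implication exists by
name as that lemma and is deliberately NOT restated here (one candidate theorem for the skeleton audit). -/
theorem TiltedLandingLaw421R_of :
    Summit.RiemannHypothesis.RiemannHypothesis.Theses.EarlyAppointments.TiltedLandingLaw421R :=
  RhW08.CreditBooks.law421R_of_creditNet_half
    stub_topPinning stub_regUmbrella11S stub_emptyNetLawHalf stub_crowdedCreditLawHalf

end Summit.RiemannHypothesis.RiemannHypothesis.Cruxes.TiltedLandingLaw421R.TrkDV13q
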